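import Literature.NumberTheory.EllipticCurves.InertiaReductionAutomorphismProofs
import HarnessLib

/-!
# A non-trivial Weierstrass automorphism fixes only `2`- and `3`-torsion (characteristic `∤ 6`);
# inertia acting non-trivially on the reduction fixes NO `p`-power torsion modulo the kernel of reduction

`Proofs` file (theorems only, no definitions, no named facts, no instances) in topic
`NumberTheory/EllipticCurves`, companion of `WeierstrassAutFixedPointsProofs` (a change of
coordinates `A` with `A • V = V` and infinitely many fixed points is `1`) and of
`InertiaReductionAutomorphismProofs` (an inertia element `σ` acts on the reduction of a good model
through a reduced change of coordinates `Ã_σ`, `red(Φ(P^σ)) = Ã_σ(red(Φ P))`). Written by the cell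
`b2b-bsdres` (sub-cell additive-p2) as the elementary local lemma behind two readings of the
additive, potentially good ORDINARY theory at `p ≥ 5` (Delbourgo 1998 §2.2 Lemma (i) / 2002 p. 39:
the local factor `ℓ_p`; and the character through which inertia acts on the étale quotient): when
the inertia twist `Ã_σ` is NOT the identity, the `Ã_σ`-fixed part of the `p`-power torsion of the
reduced curve is ZERO.

## Main results

* `WeierstrassCurve.VariableChange.eq_one_of_smul_eq_of_u_eq_one` — over a field with `2 ≠ 0`,
  `3 ≠ 0`: `A • V = V` and `u(A) = 1` force `A = 1` (`s = 0` from `a₁`, `r = 0` from `a₂`, `t = 0`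
  from `a₃`; Silverman *AEC* III.1 Table 3.1).
* `WeierstrassCurve.VariableChange.map_eq_neg_of_smul_eq_of_u_eq_neg_one` — `A • V = V` and
  `u(A) = −1` force `(r, s, t) = (0, −a₁, −a₃)`, i.e. `A` acts on `V(k)` as NEGATION.
* `WeierstrassCurve.VariableChange.two_nsmul_eq_zero_or_three_nsmul_eq_zero_of_fixed` — **a
  non-trivial automorphism fixes only `2`- and `3`-torsion**: `A • V = V`, `A ≠ 1`, `A(Q) = Q` ⟹
  `2•Q = 0 ∨ 3•Q = 0` (case `u² ≠ 1`: the abscissa of a fixed point is pinned, so the fixed point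
  `2Q` is `O`, `Q` or `−Q`; case `u = −1`: `Q = −Q`). Hence `eq_zero_of_fixed_of_nsmul_eq_zero`: a
  fixed point killed by an integer prime to `6` is `O`, in particular (`…_of_prime_pow_nsmul_eq_zero`)
  a fixed point of `p`-power order, `p ≥ 5`, is `O`. (Silverman *AEC* III.10: `Aut(E)` is
  `μ₂, μ₄, μ₆` in characteristic `∤ 6`; only the fixed-point count is needed and proved here.)
* `Literature.NumberTheory.EllipticCurves.red_eq_zero_of_red_smul_eq_of_prime_pow_nsmul_eq_zero` —
  **inertia acting non-trivially on the reduction has no fixed `p`-power torsion in the étale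
  quotient**: in the setting of `exists_reducedAut_red_map_eq` (valued field `(L, w)`, good model
  `W₀ ⊗ L = C • X_L` with unit discriminant, `σ ∈ Aut(L/F)` an isometry trivial on the residue field
  `k`, `char k ∤ 6`), if `σ` MOVES the reduction of some point (`red(Φ(P₀^σ)) ≠ red(Φ P₀)` — e.g.
  `σ` moves an `ℓ`-torsion point, `ℓ ≠ p`) then every `P ∈ X(L)` with `p^m•P = O` (`p ≥ 5` prime)
  and `red(Φ(P^σ)) = red(Φ P)` has `red(Φ P) = O`. For an elliptic curve over `ℚ_p` with additive,
  potentially good reduction becoming good over a tamely ramified extension and a generator `σ` of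
  the tame inertia of the splitting field, this is `(Ẽ'[p^∞])^{Ã_σ} = 0`: the inertia-twisted
  special fibre has NO invariant `p`-power torsion — the mechanism by which the universal-norm /
  `H¹` local term at an additive potentially good ordinary prime is trivial (Delbourgo 1998 §2.2
  Lemma (i), read with the twisted action) and by which inertia acts on the étale quotient of `T_pE`
  through a character of exact order `e = [K : ℚ_p^{nr}]` (Delbourgo 1998 §1.3 Lemma, p. 127).

Not here: Néron models, the identification of `Ã_σ` with `[ζ_e]`, any statement about `ℓ_p` or about
Delbourgo's character `ε` (those would be readings of named facts; this file is fact-free).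

Prior in the tree (Summits side, credited): `Summits/BirchSwinnertonDyer/Rank1Residual/Additive/
GoodModelInertiaDichotomy.lean` (cell `b2b-bsdres`, team n1011, seat p05, gen 6) proves
`WeierstrassCurve.VariableChange.eq_one_of_fixed_of_coprime_nsmul` — a change of variables fixing a
NON-ZERO point of order prime to `6` is `1`, in EVERY characteristic (three fixed points
`Q, −Q, 2Q`) — and the inertia dichotomy `red_smul_eq_of_smul_sub_mem_plus` on `E[p^∞]/C`, `p ≥ 5`,
in the `Γ_{ℚ_v}`-module currency of that team (non-triviality at a bad place from
Néron–Ogg–Shafarevich in `GoodModelReductionLine.lean`). The present file is the Literature-level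
(importable by Literature `Proofs` files), valued-field form, with the explicit structure of the
automorphisms with `u = ±1` in characteristic `∤ 6` and the refinement `2•Q = 0 ∨ 3•Q = 0`.

## References

* [SilvermanAEC2009] J. H. Silverman, *The Arithmetic of Elliptic Curves*, 2nd ed., III.1 Table 3.1,
  III.10 Thm. 10.1, VII.2 Prop. 2.1.
* [SerreTate1968] J.-P. Serre, J. Tate, *Good reduction of abelian varieties*, Ann. of Math. 88
  (1968), §2 (inertia acts on the special fibre through automorphisms).
* [Delbourgo1998] D. Delbourgo, Compositio Math. 113 (1998), §1.3 Lemma (p. 127), §2.2 Lemma (i).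

## Design

Pure theorems; §1–§2 in `namespace WeierstrassCurve.VariableChange` (deliberate dot-notation
extensions of Mathlib's namespace, as in `WeierstrassAutFixedPointsProofs`), §3 in
`namespace Literature.NumberTheory.EllipticCurves`. Axioms: `propext`, `Classical.choice`,
`Quot.sound`.
-/

noncomputable section

open scoped Classical NNReal
open WeierstrassCurve

universe u

namespace WeierstrassCurve

namespace VariableChange

variable {k : Type*} [Field k] (V : WeierstrassCurve k)

/-! ## §1. Automorphisms with `u = 1` and `u = −1` in characteristic `∤ 6` -/

/-- **`A • V = V` with `u(A) = 1` forces `A = 1`** when `2 ≠ 0` and `3 ≠ 0` in `k`: comparing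
`a₁ = a₁ + 2s`, `a₂ = a₂ − sa₁ + 3r − s²`, `a₃ = a₃ + ra₁ + 2t`.
[cite: SilvermanAEC2009, III.1 Table 3.1] -/
theorem eq_one_of_smul_eq_of_u_eq_one (h2 : (2 : k) ≠ 0) (h3 : (3 : k) ≠ 0) {A : VariableChange k}
    (hA : A • V = V) (hu : A.u = 1) : A = 1 := by
  have ha₁ := congrArg WeierstrassCurve.a₁ hA
  have ha₂ := congrArg WeierstrassCurve.a₂ hA
  have ha₃ := congrArg WeierstrassCurve.a₃ hA
  rw [variableChange_a₁, hu, inv_one, Units.val_one, one_mul] at ha₁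
  rw [variableChange_a₂, hu, inv_one, Units.val_one, one_pow, one_mul] at ha₂
  rw [variableChange_a₃, hu, inv_one, Units.val_one, one_pow, one_mul] at ha₃
  have hs : A.s = 0 := by
    have h : (2 : k) * A.s = 0 := by linear_combination ha₁
    exact (mul_eq_zero.mp h).resolve_left h2
  have hr : A.r = 0 := by
    rw [hs] at ha₂
    have h : (3 : k) * A.r = 0 := by linear_combination ha₂
    exact (mul_eq_zero.mp h).resolve_left h3
  have ht : A.t = 0 := by
    rw [hr] at ha₃
    have h : (2 : k) * A.t = 0 := by linear_combination ha₃
    exact (mul_eq_zero.mp h).resolve_left h2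
  cases A
  simp only [VariableChange.one_def, VariableChange.mk.injEq]
  exact ⟨hu, hr, hs, ht⟩

/-- **`A • V = V` with `u(A) = −1` forces `(r, s, t) = (0, −a₁, −a₃)`** when `2 ≠ 0` and `3 ≠ 0`
in `k` (the change of coordinates of the negation map `(x, y) ↦ (x, −y − a₁x − a₃)`).
[cite: SilvermanAEC2009, III.1 Table 3.1 and III.2 (negation)] -/
theorem r_s_t_of_smul_eq_of_u_eq_neg_one (h2 : (2 : k) ≠ 0) (h3 : (3 : k) ≠ 0)
    {A : VariableChange k} (hA : A • V = V) (hu : A.u = -1) :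
    A.r = 0 ∧ A.s = -V.a₁ ∧ A.t = -V.a₃ := by
  have ha₁ := congrArg WeierstrassCurve.a₁ hA
  have ha₂ := congrArg WeierstrassCurve.a₂ hA
  have ha₃ := congrArg WeierstrassCurve.a₃ hA
  have hinv : ((A.u⁻¹ : kˣ) : k) = -1 := by rw [hu, inv_neg, inv_one, Units.val_neg, Units.val_one]
  rw [variableChange_a₁, hinv] at ha₁
  rw [variableChange_a₂, hinv] at ha₂
  rw [variableChange_a₃, hinv] at ha₃
  have hs : A.s = -V.a₁ := by
    have h : (2 : k) * (A.s + V.a₁) = 0 := by linear_combination -ha₁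
    have h' := (mul_eq_zero.mp h).resolve_left h2
    linear_combination h'
  have hr : A.r = 0 := by
    rw [hs] at ha₂
    have h : (3 : k) * A.r = 0 := by linear_combination ha₂
    exact (mul_eq_zero.mp h).resolve_left h3
  have ht : A.t = -V.a₃ := by
    rw [hr] at ha₃
    have h : (2 : k) * (A.t + V.a₃) = 0 := by linear_combination -ha₃
    have h' := (mul_eq_zero.mp h).resolve_left h2
    linear_combination h'
  exact ⟨hr, hs, ht⟩

/-- **An automorphism with `u = −1` acts on `V(k)` as NEGATION** (`2, 3 ≠ 0` in `k`).
[cite: SilvermanAEC2009, III.2 (negation) and III.10] -/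
theorem map_eq_neg_of_smul_eq_of_u_eq_neg_one (h2 : (2 : k) ≠ 0) (h3 : (3 : k) ≠ 0)
    {A : VariableChange k} (hA : A • V = V) (hu : A.u = -1) (Q : V.toAffine.Point) :
    Affine.Point.congrEquiv hA (pointEquiv V A Q) = -Q := by
  obtain ⟨hr, hs, ht⟩ := r_s_t_of_smul_eq_of_u_eq_neg_one V h2 h3 hA hu
  have hinv : ((A.u⁻¹ : kˣ) : k) = -1 := by rw [hu, inv_neg, inv_one, Units.val_neg, Units.val_one]
  rcases Q with _ | ⟨x, y, h⟩
  · change Affine.Point.congrEquiv hA (pointEquiv V A 0) = -0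
    rw [map_zero, map_zero, neg_zero]
  · rw [pointEquiv_some, Affine.Point.congrEquiv_some, Affine.Point.neg_some]
    have hx : A.toX x = x := by rw [toX_def, hinv, hr]; ring
    have hy : A.toY x y = V.toAffine.negY x y := by
      rw [toY_def, hinv, hr, hs, ht, Affine.negY]; ring
    simp only [hx, hy]

/-! ## §2. Fixed points of a non-trivial automorphism are `2`- or `3`-torsion -/

/-- The abscissa equation of a fixed affine point: `u⁻²(x − r) = x`. [folklore] -/
private theorem toX_eq_of_fixed {A : VariableChange k} (hA : A • V = V) {x y : k}
    (h : V.toAffine.Nonsingular x y)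
    (hfix : Affine.Point.congrEquiv hA (pointEquiv V A (.some x y h)) = .some x y h) :
    ((A.u⁻¹ : kˣ) : k) ^ 2 * (x - A.r) = x := by
  rw [pointEquiv_some, Affine.Point.congrEquiv_some, Affine.Point.some.injEq] at hfix
  exact hfix.1

/-- **A NON-TRIVIAL AUTOMORPHISM FIXES ONLY `2`- AND `3`-TORSION** (characteristic `∤ 6`). Let `V`
be a Weierstrass equation over a field `k` with `2 ≠ 0`, `3 ≠ 0`, `A` a change of coordinates
with `A • V = V` and `A ≠ 1`, and `Q ∈ V(k)` a fixed point of the induced automorphism. Then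
`2•Q = O` or `3•Q = O`. Proof: write `μ = u⁻¹`. If `μ² ≠ 1` the abscissa of every affine fixed
point is `μ²r/(μ² − 1)`; `2Q` is fixed, so `2Q ∈ {O, Q, −Q}`, whence `2Q = O` or `3Q = O`. If
`μ² = 1` then `u = ±1`: `u = 1` gives `A = 1` (excluded), `u = −1` gives `A = [−1]`, `Q = −Q`.
(Silverman *AEC* III.10.1: `Aut ≅ μ₂, μ₄, μ₆` in characteristic `∤ 6` — only this consequence is
proved.) [cite: SilvermanAEC2009, III.10 Thm. 10.1 and III.1 Table 3.1] -/
theorem two_nsmul_eq_zero_or_three_nsmul_eq_zero_of_fixed (h2 : (2 : k) ≠ 0) (h3 : (3 : k) ≠ 0)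
    {A : VariableChange k} (hA : A • V = V) (hA1 : A ≠ 1) {Q : V.toAffine.Point}
    (hfix : Affine.Point.congrEquiv hA (pointEquiv V A Q) = Q) : 2 • Q = 0 ∨ 3 • Q = 0 := by
  set μ : k := ((A.u⁻¹ : kˣ) : k) with hμ
  by_cases hμ2 : μ ^ 2 = 1
  · -- `u = ±1`
    have hμ1 : μ = 1 ∨ μ = -1 := mul_self_eq_one_iff.mp (by rw [← sq]; exact hμ2)
    rcases hμ1 with h1 | h1
    · exfalso
      apply hA1
      have hu : A.u = 1 := by
        have : (A.u⁻¹ : kˣ) = 1 := Units.ext (by rw [← hμ, h1, Units.val_one])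
        simpa using this
      exact eq_one_of_smul_eq_of_u_eq_one V h2 h3 hA hu
    · have hu : A.u = -1 := by
        have : (A.u⁻¹ : kˣ) = -1 := Units.ext (by rw [← hμ, h1, Units.val_neg, Units.val_one])
        rw [inv_eq_iff_eq_inv] at this
        rw [this, inv_neg, inv_one]
      left
      have hneg := map_eq_neg_of_smul_eq_of_u_eq_neg_one V h2 h3 hA hu Q
      rw [hfix] at hneg
      rw [two_nsmul]
      nth_rw 2 [hneg]
      exact add_neg_cancel Q
  · -- `u² ≠ 1`: the abscissa of a fixed affine point is pinned down
    have h12 : μ ^ 2 - 1 ≠ 0 := sub_ne_zero.mpr hμ2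
    rcases Q with _ | ⟨x, y, h⟩
    · exact Or.inl (smul_zero _)
    · have hx : μ ^ 2 * (x - A.r) = x := toX_eq_of_fixed V hA h hfix
      -- `2Q` is fixed as well
      set φ : V.toAffine.Point →+ V.toAffine.Point :=
        (Affine.Point.congrEquiv hA : _ ≃+ _).toAddMonoidHom.comp (pointEquiv V A).toAddMonoidHom
        with hφ
      have hφapp : ∀ P, φ P = Affine.Point.congrEquiv hA (pointEquiv V A P) := fun P ↦ rfl
      have hfix2 : Affine.Point.congrEquiv hA (pointEquiv V A (2 • Affine.Point.some x y h)) =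
          2 • Affine.Point.some x y h := by
        rw [← hφapp, map_nsmul, hφapp, hfix]
      rcases h2Q : (2 • Affine.Point.some x y h : V.toAffine.Point) with _ | ⟨x', y', h'⟩
      · exact Or.inl rfl
      · rw [h2Q] at hfix2
        have hx' : μ ^ 2 * (x' - A.r) = x' := toX_eq_of_fixed V hA h' hfix2
        have hxx : x' = x := by
          have e1 : (μ ^ 2 - 1) * x = μ ^ 2 * A.r := by linear_combination hx
          have e2 : (μ ^ 2 - 1) * x' = μ ^ 2 * A.r := by linear_combination hx'
          exact mul_left_cancel₀ h12 (e2.trans e1.symm)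
        rcases Affine.Y_eq_of_X_eq h'.left h.left hxx with hyy | hyy
        · -- `2Q = Q`: then `Q = O`, absurd
          exfalso
          have hQQ : (2 • Affine.Point.some x y h : V.toAffine.Point) = Affine.Point.some x y h := by
            rw [h2Q]; simp only [hxx, hyy]
          rw [two_nsmul, add_eq_left] at hQQ
          exact Affine.Point.some_ne_zero h hQQ
        · -- `2Q = −Q`: then `3Q = O`
          right
          have hQQ : (2 • Affine.Point.some x y h : V.toAffine.Point) = -Affine.Point.some x y h := by
            rw [h2Q, Affine.Point.neg_some]; simp only [hxx, hyy]
          rw [show (3 : ℕ) = 2 + 1 from rfl, succ_nsmul, hQQ, neg_add_cancel]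

/-- **A fixed point of a non-trivial automorphism killed by an integer prime to `6` is `O`**
(characteristic `∤ 6`). [cite: SilvermanAEC2009, III.10 Thm. 10.1] -/
theorem eq_zero_of_fixed_of_nsmul_eq_zero (h2 : (2 : k) ≠ 0) (h3 : (3 : k) ≠ 0)
    {A : VariableChange k} (hA : A • V = V) (hA1 : A ≠ 1) {Q : V.toAffine.Point}
    (hfix : Affine.Point.congrEquiv hA (pointEquiv V A Q) = Q) {n : ℕ} (hn : n.Coprime 6)
    (hnQ : n • Q = 0) : Q = 0 := by
  have hord : addOrderOf Q ∣ n := addOrderOf_dvd_of_nsmul_eq_zero hnQ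
  have h23 : addOrderOf Q ∣ 6 := by
    rcases two_nsmul_eq_zero_or_three_nsmul_eq_zero_of_fixed V h2 h3 hA hA1 hfix with h | h
    · exact (addOrderOf_dvd_of_nsmul_eq_zero h).trans (by norm_num)
    · exact (addOrderOf_dvd_of_nsmul_eq_zero h).trans (by norm_num)
  have h1 : addOrderOf Q ∣ 1 := by
    have := Nat.dvd_gcd hord h23
    rwa [Nat.Coprime.gcd_eq_one hn] at this
  exact AddMonoid.addOrderOf_eq_one_iff.mp (Nat.dvd_one.mp h1)

/-- **A fixed point of a non-trivial automorphism of `p`-power order, `p ≥ 5` prime, is `O`**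
(characteristic `∤ 6`): the case `n = p^m` — the `p`-power torsion of the curve meets the fixed
subgroup of a non-trivial automorphism trivially. [cite: SilvermanAEC2009, III.10 Thm. 10.1] -/
theorem eq_zero_of_fixed_of_prime_pow_nsmul_eq_zero (h2 : (2 : k) ≠ 0) (h3 : (3 : k) ≠ 0)
    {A : VariableChange k} (hA : A • V = V) (hA1 : A ≠ 1) {Q : V.toAffine.Point}
    (hfix : Affine.Point.congrEquiv hA (pointEquiv V A Q) = Q) {p m : ℕ} (hp : p.Prime)
    (h5 : 5 ≤ p) (hQ : p ^ m • Q = 0) : Q = 0 := by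
  refine eq_zero_of_fixed_of_nsmul_eq_zero V h2 h3 hA hA1 hfix ?_ hQ
  apply Nat.Coprime.pow_left
  rw [show (6 : ℕ) = 2 * 3 from rfl]
  refine Nat.Coprime.mul_right ?_ ?_
  · exact (Nat.coprime_primes hp Nat.prime_two).mpr (by omega)
  · exact (Nat.coprime_primes hp Nat.prime_three).mpr (by omega)

/-- The identity change of coordinates induces the identity on points. [folklore] -/
private theorem congrEquiv_pointEquiv_one (hA : (1 : VariableChange k) • V = V) (Q : V.toAffine.Point) :
    Affine.Point.congrEquiv hA (pointEquiv V 1 Q) = Q := by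
  rcases Q with _ | ⟨x, y, h⟩
  · change Affine.Point.congrEquiv hA (pointEquiv V 1 0) = 0
    rw [map_zero, map_zero]
  · rw [pointEquiv_some, Affine.Point.congrEquiv_some]
    have hx : (1 : VariableChange k).toX x = x := by
      rw [toX_def, VariableChange.one_def]; simp
    have hy : (1 : VariableChange k).toY x y = y := by
      rw [toY_def, VariableChange.one_def]; simp
    simp only [hx, hy]

end VariableChange

end WeierstrassCurve

/-! ## §3. Inertia acting non-trivially on the reduction: no fixed `p`-power torsion in the étale quotient -/

namespace Literature.NumberTheory.EllipticCurves

section Inertia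

variable {L : Type u} [Field L] {w : Valuation L ℝ≥0}
  {F : Type*} [Field F] [Algebra F L]

/-- **Inertia acting NON-TRIVIALLY on the reduction has no fixed `p`-power torsion modulo the
kernel of reduction.** Setting of `exists_reducedAut_red_map_eq`: `W' = C • X_L = W₀ ⊗ L` a
`w`-integral model with unit discriminant of the base change of `X/F`, `σ ∈ Aut(L/F)` an isometry
acting trivially on the residue field `k` of `𝒪_w`, `Φ : X(L) ≃ W₀(L)` the substitution and
`red : W₀(L) → W̃₀(k)` the reduction homomorphism; assume `2 ≠ 0`, `3 ≠ 0` in `k`. If `σ` MOVES the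
reduction of some point, `red(Φ(P₀^σ)) ≠ red(Φ(P₀))` (so the reduced change of coordinates `Ã_σ`
of `InertiaReductionAutomorphismProofs` is not the identity), then every `P ∈ X(L)` of `p`-power
order (`p ≥ 5` prime) whose reduction is fixed by `σ`, `red(Φ(P^σ)) = red(Φ P)`, reduces to `O`:
`red(Φ P) = O`. Indeed `red(Φ(P^σ)) = Ã_σ(red(Φ P))`, and a non-trivial automorphism of the reduced
curve fixes only `2`- and `3`-torsion (`two_nsmul_eq_zero_or_three_nsmul_eq_zero_of_fixed`). For
`E/ℚ_p` with additive potentially good reduction, good over a tame extension `K`, and `σ` a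
generator of `Gal(K^{nr}/ℚ_p^{nr})`: the `σ`-twisted special fibre has no invariant `p`-power
torsion, `(Ẽ'[p^∞])^{Ã_σ} = 0` — the local mechanism behind Delbourgo's `ℓ_p` (1998 §2.2 Lemma (i))
and behind the order-`e` inertia character on the étale quotient (1998 §1.3 Lemma).
[cite: SerreTate1968, §2 Thm. 2 (mechanism of proof)] [cite: SilvermanAEC2009, III.10 Thm. 10.1,
VII.2 Prop. 2.1] [cite: Delbourgo1998, §1.3 Lemma (p. 127) and §2.2 Lemma (i) (readings served)] -/
theorem red_eq_zero_of_red_smul_eq_of_prime_pow_nsmul_eq_zero (X : WeierstrassCurve F)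
    (C : VariableChange L) {W₀ : WeierstrassCurve w.integer} (hW₀ : C • X.baseChange L = W₀.baseChange L)
    (hΔ : IsUnit W₀.Δ) (σ : L ≃ₐ[F] L) (hσ : ∀ z, w (σ z) = w z)
    (hσI : ∀ z, w z ≤ 1 → w (σ z - z) < 1)
    (h2 : (2 : IsLocalRing.ResidueField w.integer) ≠ 0)
    (h3 : (3 : IsLocalRing.ResidueField w.integer) ≠ 0)
    (hnt : ∃ P₀ : (X.baseChange L).toAffine.Point,
      goodReductionHom W₀ (Valuation.integer.integers w) hΔ
          (Affine.Point.congrEquiv hW₀ (VariableChange.pointEquiv (X.baseChange L) C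
            (Affine.Point.map (σ : L →ₐ[F] L) P₀))) ≠
        goodReductionHom W₀ (Valuation.integer.integers w) hΔ
          (Affine.Point.congrEquiv hW₀ (VariableChange.pointEquiv (X.baseChange L) C P₀)))
    {p m : ℕ} (hp : p.Prime) (h5 : 5 ≤ p)
    {P : (X.baseChange L).toAffine.Point} (hP : p ^ m • P = 0)
    (hfix : goodReductionHom W₀ (Valuation.integer.integers w) hΔ
          (Affine.Point.congrEquiv hW₀ (VariableChange.pointEquiv (X.baseChange L) C
            (Affine.Point.map (σ : L →ₐ[F] L) P))) =
        goodReductionHom W₀ (Valuation.integer.integers w) hΔ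
          (Affine.Point.congrEquiv hW₀ (VariableChange.pointEquiv (X.baseChange L) C P))) :
    goodReductionHom W₀ (Valuation.integer.integers w) hΔ
        (Affine.Point.congrEquiv hW₀ (VariableChange.pointEquiv (X.baseChange L) C P)) = 0 := by
  obtain ⟨Ã, hÃ, hred⟩ := exists_reducedAut_red_map_eq X C hW₀ hΔ σ hσ hσI
  set V := W₀.map (IsLocalRing.residue w.integer) with hV
  -- the reduction-of-substitution homomorphism
  set ρ : (X.baseChange L).toAffine.Point →+ V.toAffine.Point :=
    (goodReductionHom W₀ (Valuation.integer.integers w) hΔ).comp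
      ((Affine.Point.congrEquiv hW₀ : _ ≃+ _).toAddMonoidHom.comp
        (VariableChange.pointEquiv (X.baseChange L) C).toAddMonoidHom) with hρ
  have hρapp : ∀ Q, ρ Q = goodReductionHom W₀ (Valuation.integer.integers w) hΔ
      (Affine.Point.congrEquiv hW₀ (VariableChange.pointEquiv (X.baseChange L) C Q)) := fun Q ↦ rfl
  -- `Ã ≠ 1`
  have hÃ1 : Ã ≠ 1 := by
    rintro rfl
    obtain ⟨P₀, hP₀⟩ := hnt
    exact hP₀ ((hred P₀).trans (VariableChange.congrEquiv_pointEquiv_one V hÃ _))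
  -- the reduction `Q` of `Φ P` is `Ã`-fixed and of `p`-power order
  have hfixQ : Affine.Point.congrEquiv hÃ (VariableChange.pointEquiv V Ã (ρ P)) = ρ P := by
    rw [hρapp, ← hred P]
    exact hfix
  have hQ : p ^ m • ρ P = 0 := by rw [← map_nsmul, hP, map_zero]
  rw [← hρapp]
  exact VariableChange.eq_zero_of_fixed_of_prime_pow_nsmul_eq_zero V h2 h3 hÃ hÃ1 hfixQ hp h5 hQ

/-- The same with the characteristic hypothesis in the form "the residue field has characteristic
`p ≥ 5`" (`CharP k p`): then `2 ≠ 0` and `3 ≠ 0` in `k`. [folklore]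
[cite: SilvermanAEC2009, III.10 Thm. 10.1, VII.2 Prop. 2.1] -/
theorem red_eq_zero_of_red_smul_eq_of_prime_pow_nsmul_eq_zero_of_charP (X : WeierstrassCurve F)
    (C : VariableChange L) {W₀ : WeierstrassCurve w.integer} (hW₀ : C • X.baseChange L = W₀.baseChange L)
    (hΔ : IsUnit W₀.Δ) (σ : L ≃ₐ[F] L) (hσ : ∀ z, w (σ z) = w z)
    (hσI : ∀ z, w z ≤ 1 → w (σ z - z) < 1)
    {p : ℕ} (hp : p.Prime) (h5 : 5 ≤ p) [CharP (IsLocalRing.ResidueField w.integer) p]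
    (hnt : ∃ P₀ : (X.baseChange L).toAffine.Point,
      goodReductionHom W₀ (Valuation.integer.integers w) hΔ
          (Affine.Point.congrEquiv hW₀ (VariableChange.pointEquiv (X.baseChange L) C
            (Affine.Point.map (σ : L →ₐ[F] L) P₀))) ≠
        goodReductionHom W₀ (Valuation.integer.integers w) hΔ
          (Affine.Point.congrEquiv hW₀ (VariableChange.pointEquiv (X.baseChange L) C P₀)))
    {m : ℕ} {P : (X.baseChange L).toAffine.Point} (hP : p ^ m • P = 0)
    (hfix : goodReductionHom W₀ (Valuation.integer.integers w) hΔ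
          (Affine.Point.congrEquiv hW₀ (VariableChange.pointEquiv (X.baseChange L) C
            (Affine.Point.map (σ : L →ₐ[F] L) P))) =
        goodReductionHom W₀ (Valuation.integer.integers w) hΔ
          (Affine.Point.congrEquiv hW₀ (VariableChange.pointEquiv (X.baseChange L) C P))) :
    goodReductionHom W₀ (Valuation.integer.integers w) hΔ
        (Affine.Point.congrEquiv hW₀ (VariableChange.pointEquiv (X.baseChange L) C P)) = 0 := by
  have hne : ∀ q : ℕ, q.Prime → q < p → ((q : ℕ) : IsLocalRing.ResidueField w.integer) ≠ 0 := by
    intro q hq hlt h0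
    rw [CharP.cast_eq_zero_iff (IsLocalRing.ResidueField w.integer) p] at h0
    exact absurd (Nat.le_of_dvd hq.pos h0) (not_le.mpr hlt)
  have h2 : (2 : IsLocalRing.ResidueField w.integer) ≠ 0 := by
    exact_mod_cast hne 2 Nat.prime_two (by omega)
  have h3 : (3 : IsLocalRing.ResidueField w.integer) ≠ 0 := by
    exact_mod_cast hne 3 Nat.prime_three (by omega)
  exact red_eq_zero_of_red_smul_eq_of_prime_pow_nsmul_eq_zero X C hW₀ hΔ σ hσ hσI h2 h3 hnt hp h5
    hP hfix

end Inertia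

end Literature.NumberTheory.EllipticCurves

end
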